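import Summits.ResolutionOfSingularities.ResolutionOfSingularities.Theses.FoliationDescent
import Summits.ResolutionOfSingularities.ResolutionOfSingularities.Theorems.PAlterationPialtHeightOneDerivation
import Summits.ResolutionOfSingularities.ResolutionOfSingularities.Theorems.ValuativeLupiRestriction
import Summits.ResolutionOfSingularities.ResolutionOfSingularities.Theorems.PAlterationPialtSqueezeRRLU1
import Literature.AlgebraicGeometry.Resolution.LocalUniformization
import Mathlib.RingTheory.RegularLocalRing.Defs
import HarnessLib

/-!
# `Pialt` (crux stmt-ResolutionOfSingularities-0555), line `SketchIdeator2`: the BRIDGE — route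
# `FoliationDescent`'s `FolLU ∧ LogCanQuotLU` give RRLU1 over perfect fields

Helper file of the line lead (c1) (`--supports stmt-ResolutionOfSingularities-0555`; it does not
close any item). With the descent `Theorems/PAlterationPialtSqueezeRRLU1.lean`
(`isLocallyUniformizable_of_temkin2013_of_rrLU1_at`,
`hasResolution_of_temkin2013_of_rrLU1_at_of_twoModelPatching_at`) this plugs route
`FoliationDescent` (`Theses/FoliationDescent.lean`) into Zariski's programme WITHOUT its torsor
cruxes (`DualSandwich`, `TorsorLUPerfect`, `TorsorToLurelPerfect`): over a perfect field `k` of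
characteristic `p`, `Temkin2013 ∧ FolLU ∧ LogCanQuotLU` give local uniformization of every
finitely generated `K/k`, and with `TwoModelPatching` at `k` resolution of every variety over `k`.

* `isLocallyUniformizable_comap_of_model` — transport: an affine model of `K` realised inside
  `L ⊇ K` (a finitely generated `A ⊆ O` contained in the image of `K`, with `K ⊆ Frac A`,
  regular at the centre of `O`) uniformizes `O ∩ K`.
* `rrLU1_perfect_of_folLU_of_logCanQuotLU` — **`FolLU → LogCanQuotLU → RRLU1_p` over PERFECT
  ground fields**: for `L = K(y)`, `y ∉ K`, `y ^ p ∈ K`, take the derivation `D = d/dy` of `L`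
  (`exists_derivation_heightOne`: `D y = 1`, `D|_K = 0`, `D^[p] = 0`, `ker D = K`); `FolLU`
  refines the regular model `B` of `L` to `S'` on which a multiple `g • D` is non-singular or
  multiplicative; `LogCanQuotLU` (with `R = k`) returns a finitely generated algebra `A ⊆ O` of
  `D`-constants — hence inside `K` — with `Frac A = ker D = K`, regular at the centre; transport
  it to `K`. The degenerate case `y ∈ K` (`L = K`) is the regular `B` itself.
* `isLocallyUniformizable_of_temkin2013_folLU_logCanQuotLU`,
  `hasResolution_of_temkin2013_folLU_logCanQuotLU_twoModelPatching` — the consequences over a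
  perfect field (descent + Zariski–Piltant engine).

Sources: N. Jacobson, *Lectures in Abstract Algebra III*, Ch. IV §8; A. N. Rudakov,
I. R. Shafarevich, Izv. Akad. Nauk SSSR 40 (1976) (quotients by `p`-closed vector fields);
M. Temkin, J. Algebra 373 (2013), Rem. 1.3.5; O. Piltant, RACSAM 107 (2013), Prop. 5.1.
-/

set_option linter.dupNamespace false -- mandated namespace of this single-conjunct summit

noncomputable section

open IsLocalRing
open Literature.AlgebraicGeometry.Resolution
open Summit.ResolutionOfSingularities.ResolutionOfSingularities.Theses.FoliationDescent (FolLU LogCanQuotLU)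

namespace Summit.ResolutionOfSingularities.ResolutionOfSingularities.Theorems.Pialt.RadiciallyRegular

/-! ## Transport of a model realised inside a bigger field -/

/-- **An affine model of `K` realised inside `L ⊇ K` uniformizes `O ∩ K`.** Let `f : K → L` be a
`k`-algebra map of fields, `O` a valuation ring of `L`, and `A ⊆ O` a finitely generated
`k`-subalgebra of `L` contained in the image of `K`, such that every element of (the image of)
`K` is a quotient of elements of `A`, and whose local ring at the centre of `O` is regular. Then
`A ∩ K` (`A.comap f`) is a finitely generated affine model of `K` inside `O ∩ K`, regular at the
centre of `O ∩ K` — so `O ∩ K` is locally uniformizable over `k`. [folklore] -/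
theorem isLocallyUniformizable_comap_of_model {k K L : Type} [Field k] [Field K] [Field L]
    [Algebra k K] [Algebra k L] (f : K →ₐ[k] L) (O : ValuationSubring L) (A : Subalgebra k L)
    (hA : A.toSubring ≤ O.toSubring) (hAK : ∀ x ∈ A, x ∈ Set.range f) (hfg : A.FG)
    (hfrac : ∀ z : K, ∃ a b : L, a ∈ A ∧ b ∈ A ∧ b ≠ 0 ∧ f z = a / b)
    (hreg : IsRegularLocalRing (Localization.AtPrime
      (Ideal.comap (Subring.inclusion hA) (maximalIdeal O)))) :
    IsLocallyUniformizable k K (O.comap (f : K →+* L)) := by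
  classical
  have hfinj : Function.Injective f := (f : K →+* L).injective
  set A₀ : Subalgebra k K := A.comap f with hA₀
  have hmap : A₀.map f = A := by
    rw [hA₀, Subalgebra.map_comap_eq]
    exact inf_eq_left.mpr fun x hx => hAK x hx
  have h₀ : A₀.toSubring ≤ (O.comap (f : K →+* L)).toSubring := fun x hx => hA hx
  have hA₀fg : A₀.FG := Subalgebra.fg_of_fg_map _ f hfinj (by rw [hmap]; exact hfg)
  have hA₀fr : IsFractionRing A₀ K := by
    refine IsFractionRing.of_field A₀ K fun z => ?_
    obtain ⟨a, b, ha, hb, hb0, hz⟩ := hfrac z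
    obtain ⟨a₀, rfl⟩ := hAK a ha
    obtain ⟨b₀, rfl⟩ := hAK b hb
    refine ⟨⟨a₀, show f a₀ ∈ A from ha⟩, ⟨b₀, show f b₀ ∈ A from hb⟩, hfinj ?_⟩
    rw [hz, map_div₀]
    rfl
  refine ⟨A₀, h₀, hA₀fg, hA₀fr, ?_⟩
  -- transport of the local ring at the centre along `A₀ ≅ A₀.map f = A`
  have hmapS : A₀.toSubring.map (f : K →+* L) = A.toSubring := by
    ext z
    simp only [Subring.mem_map, Subalgebra.mem_toSubring]
    constructor
    · rintro ⟨x, hx, rfl⟩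
      exact hx
    · intro hz
      obtain ⟨x, rfl⟩ := hAK z hz
      exact ⟨x, hz, rfl⟩
  let e : A₀.toSubring ≃+* A.toSubring :=
    (A₀.toSubring.equivMapOfInjective (f : K →+* L) hfinj).trans (RingEquiv.subringCongr hmapS)
  have he : ∀ a : A₀.toSubring, ((e a : A.toSubring) : L) = f a := fun a => rfl
  set P : Ideal A.toSubring := Ideal.comap (Subring.inclusion hA) (maximalIdeal O) with hP
  haveI hPp : P.IsPrime := Ideal.comap_isPrime _ _
  have hPe : P.comap (e : A₀.toSubring →+* A.toSubring) =
      Ideal.comap (Subring.inclusion h₀) (maximalIdeal (O.comap (f : K →+* L))) := by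
    ext a
    have h2 : Subring.inclusion hA (e a) = ⟨f a, hA (e a).2⟩ := Subtype.ext (he a)
    simp only [Ideal.mem_comap, hP, RingHom.coe_coe]
    rw [h2]
    exact (Lupi.mk_mem_maximalIdeal_comap_iff O (f : K →+* L) (h₀ a.2)).symm
  haveI : (P.comap (e : A₀.toSubring →+* A.toSubring)).IsPrime := Ideal.comap_isPrime _ _
  exact isRegularLocalRing_localization_atPrime_congr hPe
    ((Lupi.isRegularLocalRing_localization_iff_of_ringEquiv e P).mp hreg)

/-- The local ring of a regular ring `B ⊆ L` at the centre of a valuation ring `O ⊇ B` is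
regular (bookkeeping between `↥B` and `↥B.toSubring`). [folklore] -/
theorem isRegularLocalRing_centre_of_isRegularRing {k L : Type} [Field k] [Field L]
    [Algebra k L] (B : Subalgebra k L) [IsRegularRing B] (O : ValuationSubring L)
    (hB : B.toSubring ≤ O.toSubring) :
    IsRegularLocalRing (Localization.AtPrime
      (Ideal.comap (Subring.inclusion hB) (maximalIdeal O))) := by
  let e : B ≃+* B.toSubring :=
    { toFun := fun x => ⟨x.1, x.2⟩
      invFun := fun x => ⟨x.1, x.2⟩
      left_inv := fun _ => rfl
      right_inv := fun _ => rfl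
      map_mul' := fun _ _ => rfl
      map_add' := fun _ _ => rfl }
  haveI : IsRegularRing B.toSubring := IsRegularRing.of_ringEquiv e
  exact IsRegularRing.isRegularLocalRing_localization _

/-! ## The bridge -/

/-- **`FolLU → LogCanQuotLU → RRLU1_p` over perfect ground fields** (see the module docstring):
route `FoliationDescent`'s foliation local uniformization and log-canonical quotient
uniformization give local uniformization below every height-one Frobenius sandwich
`K ⊆ K(y)`, `y ^ p ∈ K`, of a regular affine variety, over a perfect field of characteristic
`p`. [folklore] -/
theorem rrLU1_perfect_of_folLU_of_logCanQuotLU (hF : FolLU) (hQ : LogCanQuotLU) (p : ℕ)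
    (hp : p.Prime) :
    ∀ (k K L : Type) [Field k] [CharP k p] [PerfectField k] [Field K] [Field L] [Algebra k K]
      [Algebra K L] [Algebra k L] [IsScalarTower k K L], (⊤ : IntermediateField k K).FG →
      IsPurelyInseparable K L →
      (∃ y : L, y ^ p ∈ (algebraMap K L).range ∧ IntermediateField.adjoin K {y} = ⊤) →
      ∀ B : Subalgebra k L, B.FG → IsFractionRing B L → IsRegularRing B →
      ∀ O : ValuationSubring L, B.toSubring ≤ O.toSubring →
        IsLocallyUniformizable k K (O.comap (algebraMap K L)) := by
  intro k K L _ _ _ _ _ _ _ _ _ _hfg _hpi hy B hBfg hBfr hBreg O hBO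
  classical
  haveI : Fact p.Prime := ⟨hp⟩
  haveI : CharP K p := charP_of_injective_algebraMap (algebraMap k K).injective p
  haveI := hBfr
  obtain ⟨y, hyp, htop⟩ := hy
  let f : K →ₐ[k] L := IsScalarTower.toAlgHom k K L
  have hf : (f : K →+* L) = algebraMap K L := rfl
  rw [← hf]
  by_cases hyK : y ∈ (algebraMap K L).range
  · -- degenerate case `L = K`: the regular `B` itself
    have hsurj : Function.Surjective (algebraMap K L) := by
      intro z
      have hz : z ∈ (⊤ : IntermediateField K L) := IntermediateField.mem_top
      rw [← htop] at hz
      have hle : IntermediateField.adjoin K {y} ≤ ⊥ := by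
        rw [IntermediateField.adjoin_le_iff]
        rintro _ rfl
        obtain ⟨c, hc⟩ := hyK
        exact hc ▸ (⊥ : IntermediateField K L).algebraMap_mem c
      obtain ⟨c, hc⟩ := IntermediateField.mem_bot.mp (hle hz)
      exact ⟨c, hc⟩
    refine isLocallyUniformizable_comap_of_model f O B hBO (fun x _ => hsurj x) hBfg
      (fun z => ?_) (isRegularLocalRing_centre_of_isRegularRing B O hBO)
    obtain ⟨a, b, hb, hab⟩ := IsFractionRing.div_surjective (A := B) (f z)
    exact ⟨a, b, a.2, b.2, fun h => nonZeroDivisors.ne_zero hb (Subtype.ext h), hab.symm⟩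
  · -- the height-one step: `D = d/dy`
    obtain ⟨D, hDy, hDK, hDp, hDker⟩ := exists_derivation_heightOne k y hyK hyp htop
    have hD0 : D ≠ 0 := by
      intro h
      rw [h] at hDy
      exact zero_ne_one hDy
    have hDpc : ∃ c : L, ∀ x : L, (⇑D)^[p] x = c * D x := ⟨0, fun x => by rw [hDp, zero_mul]⟩
    -- `FolLU`: refine `B` to `S'` with `g • D` non-singular or multiplicative
    obtain ⟨S', h', g, _hBS', hS'fg, hS'fr, hS'reg, hg, hpres, hcases⟩ :=
      hF p hp k L O B hBO D hBfg hBfr (isRegularLocalRing_centre_of_isRegularRing B O hBO)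
        hD0 hDpc
    -- `LogCanQuotLU` with `R = k`
    have hRfg : (⊥ : Subalgebra k L).FG := Subalgebra.fg_bot
    have hRconst : ∀ x ∈ (⊥ : Subalgebra k L), D x = 0 := by
      intro x hx
      obtain ⟨c, rfl⟩ := Algebra.mem_bot.mp hx
      exact D.map_algebraMap c
    obtain ⟨A, hA, -, hAfg, hAconst, hAfrac, hAreg⟩ :=
      hQ p hp k L O S' h' D g ⊥ hS'fg hS'fr hS'reg hD0 hDpc hg hpres hcases hRfg bot_le hRconst
    -- `A ⊆ K`, `K ⊆ Frac A`: transport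
    refine isLocallyUniformizable_comap_of_model f O A hA (fun x hx => ?_) hAfg
      (fun z => ?_) hAreg
    · obtain ⟨c, hc⟩ := hDker x (hAconst x hx)
      exact ⟨c, hc⟩
    · obtain ⟨a, b, ha, hb, hb0, hz⟩ := hAfrac (f z) (hDK z)
      exact ⟨a, b, ha, hb, hb0, hz⟩

/-! ## Consequences over a perfect field -/

/-- **Local uniformization over a perfect field from `Temkin2013 ∧ FolLU ∧ LogCanQuotLU`**: the
bridge `rrLU1_perfect_of_folLU_of_logCanQuotLU` feeds the descent
`isLocallyUniformizable_of_temkin2013_of_rrLU1_at` over the perfect field `k` — no torsor crux,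
no dual sandwich. [cite: Temkin2013, Thm. 1.3.2 and Rem. 1.3.5 (ii)–(iii)] -/
theorem isLocallyUniformizable_of_temkin2013_folLU_logCanQuotLU (hT : Temkin2013.{0})
    (hF : FolLU) (hQ : LogCanQuotLU) {p : ℕ} [Fact p.Prime] (k : Type) [Field k] [CharP k p]
    [PerfectField k] (K : Type) [Field K] [Algebra k K] (hfg : (⊤ : IntermediateField k K).FG)
    (O : ValuationSubring K) (hO : ∀ c : k, algebraMap k K c ∈ O) :
    IsLocallyUniformizable k K O :=
  isLocallyUniformizable_of_temkin2013_of_rrLU1_at hT k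
    (fun K' L' _ _ _ _ _ _ => rrLU1_perfect_of_folLU_of_logCanQuotLU hF hQ p Fact.out k K' L')
    K hfg O hO

/-- **Resolution over a perfect field from `Temkin2013 ∧ FolLU ∧ LogCanQuotLU` and two-model
patching over that field** (Zariski–Piltant engine, field by field:
`hasResolution_of_temkin2013_of_rrLU1_at_of_twoModelPatching_at`). For route `FoliationDescent`
this replaces `DualSandwich → TorsorLUPerfect → TorsorToLurelPerfect → PatchingRelPerfect` by the
bridge + descent + Piltant's two-model patching. [cite: Piltant2013, Prop. 5.1 and Cor. 5.7] -/
theorem hasResolution_of_temkin2013_folLU_logCanQuotLU_twoModelPatching (hT : Temkin2013.{0})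
    (hF : FolLU) (hQ : LogCanQuotLU) {p : ℕ} [Fact p.Prime] (k : Type) [Field k] [CharP k p]
    [PerfectField k]
    (hZ : ∀ (K : Type) [Field K] [Algebra k K] [Algebra.EssFiniteType k K],
      ∀ M₁ M₂ : ProperModel k K,
        ∃ (N : ProperModel k K) (φ₁ : N.Hom M₁) (φ₂ : N.Hom M₂), φ₁.RegLe ∧ φ₂.RegLe)
    (X : AlgebraicGeometry.Scheme.{0}) (f : X ⟶ AlgebraicGeometry.Spec (.of k))
    [AlgebraicGeometry.IsSeparated f] [AlgebraicGeometry.LocallyOfFiniteType f]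
    [AlgebraicGeometry.QuasiCompact f] [AlgebraicGeometry.IsReduced X] :
    Scheme.HasResolution X :=
  hasResolution_of_temkin2013_of_rrLU1_at_of_twoModelPatching_at hT k
    (fun K' L' _ _ _ _ _ _ => rrLU1_perfect_of_folLU_of_logCanQuotLU hF hQ p Fact.out k K' L')
    hZ X f

/-! ## By name (appended, lead c2): the registered stub `stub_foliationBridge` of line `foliation_sandwich` -/

/-- **Registered stub `stub_foliationBridge`** (line `foliation_sandwich` of crux stmt-0555,
`Cruxes/Pialt/Lines/foliation_sandwich.lean`): `FolLU → LogCanQuotLU →` RRLU1 over perfect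
fields — by name, the bridge `rrLU1_perfect_of_folLU_of_logCanQuotLU` above.
[cite: Temkin2013, Rem. 1.3.5 (ii)–(iii)] -/
theorem stub_foliationBridge (hF : FolLU) (hQ : LogCanQuotLU) (p : ℕ) (hp : p.Prime) :
    ∀ (k K L : Type) [Field k] [CharP k p] [PerfectField k] [Field K] [Field L] [Algebra k K]
      [Algebra K L] [Algebra k L] [IsScalarTower k K L], (⊤ : IntermediateField k K).FG →
      IsPurelyInseparable K L →
      (∃ y : L, y ^ p ∈ (algebraMap K L).range ∧ IntermediateField.adjoin K {y} = ⊤) →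
      ∀ B : Subalgebra k L, B.FG → IsFractionRing B L → IsRegularRing B →
      ∀ O : ValuationSubring L, B.toSubring ≤ O.toSubring →
        IsLocallyUniformizable k K (O.comap (algebraMap K L)) :=
  rrLU1_perfect_of_folLU_of_logCanQuotLU hF hQ p hp

end Summit.ResolutionOfSingularities.ResolutionOfSingularities.Theorems.Pialt.RadiciallyRegular

end
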